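import Literature.NumberTheory.Sieve.TwistedWeightMellin
import Mathlib.Analysis.MellinInversion
import HarnessLib

/-!
# Mellin inversion for the twisted weight `v²(1−v)² e(λv)`

Topic `Literature/NumberTheory/Sieve`; a PROVED tool file toward
`Literature.NumberTheory.DiophantineGeometry.XYZUpperHalf` ([Harper2016, Cor. 1], smoothed major
arcs). The weight `W_λ(v) = v²(1−v)² e(λv)` on `(0,1]` (zero elsewhere) has Mellin transform
`mellin W_λ s = Ŵ_λ(s) = twistMellin λ s`, convergent for `Re s > −2`; its vertical integrability on
`Re s = σ > 0` follows from the decay `norm_twistMellin_le_decay`, whence Mellin inversion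
(`mellinInv_mellin_eq`):

`twistWeight_eq_mellinInv`: `W_λ(v) = (2π)⁻¹ ∫ v^{−(σ+it)} Ŵ_λ(σ+it) dt` for `v > 0`, `σ > 0`.

## References

* E. C. Titchmarsh, *Introduction to the Theory of Fourier Integrals*, §1.29 (Mellin inversion) [Titchmarsh1948].
* A. J. Harper, Compositio Math. 152 (2016), §5 [Harper2016].
-/

noncomputable section

open Real Complex MeasureTheory Set intervalIntegral Filter Asymptotics
open scoped FourierTransform Topology

namespace Literature.NumberTheory.Sieve

namespace TwistedWeight

/-- The twisted weight `W_λ(v) = v²(1−v)² e(λv)` for `0 < v ≤ 1`, and `0` otherwise.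
[cite: Harper2016, §5] -/
def twistWeight (lam : ℝ) (v : ℝ) : ℂ :=
  if v ∈ Ioc (0 : ℝ) 1 then ((((v ^ 2 * (1 - v) ^ 2 : ℝ)) : ℂ)) * (𝐞 (lam * v) : ℂ) else 0

/-- `W_λ` on `(0,1]`. [folklore] -/
theorem twistWeight_of_mem {lam v : ℝ} (hv : v ∈ Ioc (0 : ℝ) 1) :
    twistWeight lam v = ((((v ^ 2 * (1 - v) ^ 2 : ℝ)) : ℂ)) * (𝐞 (lam * v) : ℂ) := if_pos hv

/-- `W_λ = 0` off `(0,1]`. [folklore] -/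
theorem twistWeight_of_not_mem {lam v : ℝ} (hv : v ∉ Ioc (0 : ℝ) 1) : twistWeight lam v = 0 := if_neg hv

/-- `‖W_λ(v)‖ ≤ 1` everywhere (indeed `≤ v²(1−v)² ≤ 1/16`). [folklore] -/
theorem norm_twistWeight_le (lam v : ℝ) : ‖twistWeight lam v‖ ≤ 1 := by
  by_cases hv : v ∈ Ioc (0 : ℝ) 1
  · rw [twistWeight_of_mem hv, norm_mul, Circle.norm_coe, mul_one, Complex.norm_real, Real.norm_eq_abs,
      abs_of_nonneg (by positivity)]
    obtain ⟨h0, h1⟩ := hv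
    have : v * (1 - v) ≤ 1 := by nlinarith
    calc v ^ 2 * (1 - v) ^ 2 = (v * (1 - v)) ^ 2 := by ring
      _ ≤ 1 := by
          have h2 : 0 ≤ v * (1 - v) := by nlinarith
          nlinarith
  · rw [twistWeight_of_not_mem hv, norm_zero]; exact zero_le_one

/-- The smooth formula agreeing with `W_λ` on `[0,1]` is continuous on `ℝ`. [folklore] -/
theorem continuous_twistWeight_formula (lam : ℝ) :
    Continuous fun v : ℝ => ((((v ^ 2 * (1 - v) ^ 2 : ℝ)) : ℂ)) * (𝐞 (lam * v) : ℂ) :=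
  (Complex.continuous_ofReal.comp (by fun_prop)).mul
    (continuous_iff_continuousAt.mpr fun v => (hasDerivAt_fourierChar_mul lam v).differentiableAt.continuousAt)

/-- `W_λ` is continuous on `(0, ∞)`. [folklore] -/
theorem continuousOn_twistWeight (lam : ℝ) : ContinuousOn (twistWeight lam) (Ioi 0) := by
  -- on `(0, ∞)`, `W_λ` agrees with the continuous function `v ↦ 1_{v ≤ 1} · formula`, and the
  -- formula vanishes at `v = 1`
  have hform := continuous_twistWeight_formula lam
  intro v hv
  rcases lt_trichotomy v 1 with h1 | h1 | h1
  · -- near `v < 1` (and `v > 0`): `W = formula`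
    have hev : twistWeight lam =ᶠ[𝓝 v] fun v => ((((v ^ 2 * (1 - v) ^ 2 : ℝ)) : ℂ)) * (𝐞 (lam * v) : ℂ) := by
      have : Ioo (0 : ℝ) 1 ∈ 𝓝 v := Ioo_mem_nhds hv h1
      filter_upwards [this] with w hw
      exact twistWeight_of_mem ⟨hw.1, hw.2.le⟩
    exact (hform.continuousAt.congr hev.symm).continuousWithinAt
  · -- at `v = 1`: both one-sided limits are `0 = W(1)`
    subst h1
    have hval : twistWeight lam 1 = 0 := by rw [twistWeight_of_mem ⟨one_pos, le_rfl⟩]; simp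
    apply ContinuousAt.continuousWithinAt
    rw [ContinuousAt, hval]
    have h0 : Tendsto (fun v : ℝ => ((((v ^ 2 * (1 - v) ^ 2 : ℝ)) : ℂ)) * (𝐞 (lam * v) : ℂ)) (𝓝 1) (𝓝 0) := by
      have := hform.continuousAt (x := (1 : ℝ))
      rw [ContinuousAt] at this; simpa using this
    -- `‖W v‖ ≤ ‖formula v‖` for all `v`
    have h0' : Tendsto (fun v : ℝ => ‖((((v ^ 2 * (1 - v) ^ 2 : ℝ)) : ℂ)) * (𝐞 (lam * v) : ℂ)‖) (𝓝 1) (𝓝 0) := by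
      have := h0.norm; rwa [norm_zero] at this
    refine squeeze_zero_norm (fun w => ?_) h0'
    by_cases hw : w ∈ Ioc (0 : ℝ) 1
    · rw [twistWeight_of_mem hw]
    · rw [twistWeight_of_not_mem hw, norm_zero]; exact norm_nonneg _
  · -- `v > 1`: `W = 0` near `v`
    have hev : twistWeight lam =ᶠ[𝓝 v] fun _ => (0 : ℂ) := by
      have : Ioi (1 : ℝ) ∈ 𝓝 v := Ioi_mem_nhds h1
      filter_upwards [this] with w hw
      exact twistWeight_of_not_mem (fun h => absurd h.2 (not_le.mpr hw))
    exact (continuousAt_const.congr hev.symm).continuousWithinAt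

/-! ### The Mellin transform of `W_λ` is `Ŵ_λ` -/

/-- `mellin W_λ s = Ŵ_λ(s)` for `Re s > 0`. [folklore] -/
theorem mellin_twistWeight (s : ℂ) (lam : ℝ) :
    mellin (twistWeight lam) s = twistMellin lam s := by
  rw [mellin, twistMellin, intervalIntegral.integral_of_le zero_le_one]
  rw [setIntegral_eq_of_subset_of_forall_sdiff_eq_zero (s := Ioc (0 : ℝ) 1) measurableSet_Ioi
    Ioc_subset_Ioi_self (fun v hv => by
      rw [twistWeight_of_not_mem (fun h => hv.2 h), smul_zero])]
  refine setIntegral_congr_fun measurableSet_Ioc fun v hv => ?_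
  rw [twistWeight_of_mem hv, smul_eq_mul]
  have hv0 : (v : ℂ) ≠ 0 := by exact_mod_cast hv.1.ne'
  have e : (v : ℂ) ^ (s + 1) = (v : ℂ) ^ (s - 1) * (v : ℂ) ^ (2 : ℕ) := by
    rw [← Complex.cpow_natCast, ← Complex.cpow_add _ _ hv0]; congr 1; push_cast; ring
  rw [e]; push_cast; ring

/-- `W_λ` is locally integrable on `(0, ∞)`. [folklore] -/
theorem locallyIntegrableOn_twistWeight (lam : ℝ) : LocallyIntegrableOn (twistWeight lam) (Ioi 0) :=
  (continuousOn_twistWeight lam).locallyIntegrableOn measurableSet_Ioi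

/-- The Mellin transform of `W_λ` converges for `Re s > 0` (indeed for `Re s > −2`). [folklore] -/
theorem mellinConvergent_twistWeight {s : ℂ} (hs : 0 < s.re) (lam : ℝ) :
    MellinConvergent (twistWeight lam) s := by
  refine mellinConvergent_of_isBigO_rpow (a := s.re + 1) (b := -1) (locallyIntegrableOn_twistWeight lam)
    ?_ (by linarith) ?_ (by linarith)
  · -- `W = 0` eventually at `+∞`
    have hev : twistWeight lam =ᶠ[atTop] fun _ => (0 : ℂ) := by
      filter_upwards [eventually_gt_atTop (1 : ℝ)] with v hv
      exact twistWeight_of_not_mem (fun h => absurd h.2 (not_le.mpr hv))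
    exact (isBigO_zero _ _).congr' hev.symm EventuallyEq.rfl
  · -- near `0+`: `‖W v‖ ≤ v = v^{-(-1)}`
    refine IsBigO.of_bound 1 ?_
    have : Ioc (0 : ℝ) 1 ∈ 𝓝[>] (0 : ℝ) := Ioc_mem_nhdsGT one_pos
    filter_upwards [this] with v hv
    rw [twistWeight_of_mem hv, norm_mul, Circle.norm_coe, mul_one, Complex.norm_real, Real.norm_eq_abs,
      abs_of_nonneg (by positivity), one_mul, neg_neg, Real.rpow_one, Real.norm_eq_abs, abs_of_pos hv.1]
    obtain ⟨h0, h1⟩ := hv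
    have : v * (1 - v) ^ 2 ≤ 1 := by nlinarith
    nlinarith

/-! ### Vertical integrability and inversion -/

/-- Joint continuity of the integrand of `Ŵ_λ(σ + it)` in `(t, v)`. [folklore] -/
theorem continuous_integrand_uncurry {σ : ℝ} (hσ : 0 < σ) (lam : ℝ) :
    Continuous (Function.uncurry fun (t : ℝ) (v : ℝ) =>
      (v : ℂ) ^ ((σ : ℂ) + t * I + 1) * ((((1 - v) ^ 2 : ℝ)) : ℂ) * (𝐞 (lam * v) : ℂ)) := by
  apply Continuous.mul
  apply Continuous.mul
  · -- `(t, v) ↦ v ^ (σ + 1 + it)`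
    set G : ℝ × ℝ → ℝ × ℂ := fun p => (p.2, ((σ : ℂ) + p.1 * I + 1)) with hG
    set F : ℝ × ℂ → ℂ := fun q => (q.1 : ℂ) ^ q.2 with hF
    have h1 : Continuous G := by rw [hG]; fun_prop
    have h2 : ∀ p : ℝ × ℝ, ContinuousAt F (G p) :=
      fun p => Complex.continuousAt_ofReal_cpow _ _ (Or.inl (by simp; linarith))
    have h3 : Continuous (F ∘ G) := continuous_iff_continuousAt.mpr fun p => (h2 p).comp h1.continuousAt
    exact h3
  · exact Complex.continuous_ofReal.comp (by fun_prop)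
  · exact continuous_iff_continuousAt.mpr fun p =>
      ((hasDerivAt_fourierChar_mul lam p.2).differentiableAt.continuousAt.comp continuous_snd.continuousAt)

/-- `t ↦ Ŵ_λ(σ + it)` is continuous. [folklore] -/
theorem continuous_twistMellin_vertical {σ : ℝ} (hσ : 0 < σ) (lam : ℝ) :
    Continuous fun t : ℝ => twistMellin lam (σ + t * I) := by
  unfold twistMellin
  exact intervalIntegral.continuous_parametric_intervalIntegral_of_continuous' (continuous_integrand_uncurry hσ lam) 0 1

/-- `t ↦ Ŵ_λ(σ + it)` is integrable (`σ > 0`). [folklore] -/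
theorem integrable_twistMellin_vertical {σ : ℝ} (hσ : 0 < σ) (lam : ℝ) :
    Integrable fun t : ℝ => twistMellin lam (σ + t * I) := by
  set Cl : ℝ := 2 + 6 * (2 * π * |lam|) + 6 * (2 * π * |lam|) ^ 2 + (2 * π * |lam|) ^ 3 with hC
  have hC0 : 0 ≤ Cl := by have := Real.pi_pos; positivity
  refine Integrable.mono' (g := fun t : ℝ => Cl * (1 + t ^ 2)⁻¹) (integrable_inv_one_add_sq.const_mul Cl)
    (continuous_twistMellin_vertical hσ lam).aestronglyMeasurable (Eventually.of_forall fun t => ?_)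
  have hs : 0 < ((σ : ℂ) + t * I).re := by simp; exact hσ
  refine (norm_twistMellin_le_decay hs lam).trans ?_
  rw [← hC]
  -- `‖s+2‖ ‖s+3‖ ‖s+4‖ ≥ (1 + t²)`
  have h2 : 1 + t ^ 2 ≤ ‖(σ : ℂ) + t * I + 2‖ * ‖(σ : ℂ) + t * I + 3‖ * ‖(σ : ℂ) + t * I + 4‖ := by
    have n2 : ‖(σ : ℂ) + t * I + 2‖ ^ 2 = (σ + 2) ^ 2 + t ^ 2 := by
      rw [Complex.sq_norm, Complex.normSq_apply]; simp; ring
    have n3 : ‖(σ : ℂ) + t * I + 3‖ ^ 2 = (σ + 3) ^ 2 + t ^ 2 := by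
      rw [Complex.sq_norm, Complex.normSq_apply]; simp; ring
    have n4 : ‖(σ : ℂ) + t * I + 4‖ ^ 2 = (σ + 4) ^ 2 + t ^ 2 := by
      rw [Complex.sq_norm, Complex.normSq_apply]; simp; ring
    have hge2 : 1 + t ^ 2 ≤ ‖(σ : ℂ) + t * I + 2‖ ^ 2 := by rw [n2]; nlinarith
    have h23 : ‖(σ : ℂ) + t * I + 2‖ ≤ ‖(σ : ℂ) + t * I + 3‖ := by
      have : ‖(σ : ℂ) + t * I + 2‖ ^ 2 ≤ ‖(σ : ℂ) + t * I + 3‖ ^ 2 := by rw [n2, n3]; nlinarith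
      exact (pow_le_pow_iff_left₀ (norm_nonneg _) (norm_nonneg _) two_ne_zero).1 this
    have hn4 : 1 ≤ ‖(σ : ℂ) + t * I + 4‖ := by
      have : (1 : ℝ) ^ 2 ≤ ‖(σ : ℂ) + t * I + 4‖ ^ 2 := by rw [n4]; nlinarith
      exact (pow_le_pow_iff_left₀ zero_le_one (norm_nonneg _) two_ne_zero).1 this
    calc 1 + t ^ 2 ≤ ‖(σ : ℂ) + t * I + 2‖ ^ 2 := hge2
      _ = ‖(σ : ℂ) + t * I + 2‖ * ‖(σ : ℂ) + t * I + 2‖ * 1 := by ring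
      _ ≤ ‖(σ : ℂ) + t * I + 2‖ * ‖(σ : ℂ) + t * I + 3‖ * ‖(σ : ℂ) + t * I + 4‖ :=
          mul_le_mul (mul_le_mul_of_nonneg_left h23 (norm_nonneg _)) hn4 zero_le_one (by positivity)
  have hpos : 0 < 1 + t ^ 2 := by positivity
  calc Cl / (‖(σ : ℂ) + t * I + 2‖ * ‖(σ : ℂ) + t * I + 3‖ * ‖(σ : ℂ) + t * I + 4‖)
      ≤ Cl / (1 + t ^ 2) := div_le_div_of_nonneg_left hC0 hpos h2
    _ = Cl * (1 + t ^ 2)⁻¹ := div_eq_mul_inv _ _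

/-- `mellin W_λ` is vertically integrable on `Re s = σ > 0`. [folklore] -/
theorem verticalIntegrable_mellin_twistWeight {σ : ℝ} (hσ : 0 < σ) (lam : ℝ) :
    Complex.VerticalIntegrable (mellin (twistWeight lam)) σ := by
  rw [Complex.VerticalIntegrable]
  refine (integrable_twistMellin_vertical hσ lam).congr (Eventually.of_forall fun t => ?_)
  exact (mellin_twistWeight _ lam).symm

/-- **Mellin inversion for the twisted weight**: for `v > 0` and `σ > 0`,
`W_λ(v) = (2π)⁻¹ ∫ v^{−(σ+it)} Ŵ_λ(σ+it) dt`. [cite: Titchmarsh1948, §1.29] -/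
theorem twistWeight_eq_mellinInv {σ : ℝ} (hσ : 0 < σ) (lam : ℝ) {v : ℝ} (hv : 0 < v) :
    twistWeight lam v =
      (1 / (2 * π)) • ∫ t : ℝ, (v : ℂ) ^ (-((σ : ℂ) + t * I)) • twistMellin lam (σ + t * I) := by
  have hinv := mellinInv_mellin_eq σ (twistWeight lam) hv (mellinConvergent_twistWeight (by simp; exact hσ) lam)
    (verticalIntegrable_mellin_twistWeight hσ lam)
    ((continuousOn_twistWeight lam).continuousAt (Ioi_mem_nhds hv))
  rw [← hinv, mellinInv]
  congr 1
  refine integral_congr_ae (Eventually.of_forall fun t => ?_)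
  simp only
  rw [mellin_twistWeight]

end TwistedWeight

end Literature.NumberTheory.Sieve

end
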